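import Summits.AtomisticToContinuum.Crystallization.Theorems.ExcessDecayLiouvilleHcpLiouvilleDefs

/-!
# Line `anchored-split` for the crux `HcpLiouville` (stmt-AtomisticToContinuum-9332) — crux-strategist ALTERNATIVE line

Registered ALONGSIDE the lead's line `Sketch` (v3 dead at `stub_boxCoercive`; v4 = quantitative blow-down under
`SecantCoercive (1/20) ∧ relaxedShift`, being rebuilt by lead c1).  It never touches `Lines/Sketch.lean` or its stubs.

THE CUT.  The matching datum `(t, A)` of the crux need not be an equilibrium two-lattice: `Inner t A` is measured
from the GEOMETRIC hcp shift (slack `1/40`) and the relaxed (force-free) inner shift of the cell `A` is up to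
`0.022` off geometric at the pure-shear corners of `Adm` (kit j014378).  Hence the anchor shift `τ` of every
energy-method line is up to `≈ 0.047`, the inter-sublattice strains of `X` seen from the anchor reach `≈ 0.1`, and
the ONE inhomogeneous coercivity certificate all lines consume must hold along rays of that length — where tangent
coercivity is certified false (kit j017763), null-Lagrangian-corrected cells are negative (kit j011259 at vertex
radius `1/20`) and only the uncertified bilinear ray-secant constant (`0.22–0.31` in floats, kit j015986) is left.
This line cuts the crux along the ANCHORING REGIME instead of along proof levels:

* `stub_anchoredSecant : ∃ κ₁ > 0, SecantCoercive 0 κ₁` — ray-secant coercivity from EQUILIBRIUM data only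
  (`τ = 0`, ray radius `1/40`, inter-sublattice strain `≤ 1/20`): the `ρ = 0` slice of the lead's input
  (`SecantCoercive (1/20) κ₁ → SecantCoercive 0 κ₁` trivially), bilinear `κ_sec,adv = 0.23–0.41` at ray length
  `0.025` (kit j015986), and — in the weighted own-field form the Caccioppoli step really consumes — certifiable
  CELLWISE today (`+0.07…+0.21` at vertex radius `1/40`, kit j011259; the dilated cell needs its own `μ`).
* `stub_anchoredBlowdown` — the blow-down Liouville theorem for equilibrium data: `PhononStability` (linear
  theory at the datum: lattice Green's operator `ℓ¹,1 → ℓ²`, interior oscillation decay) and `SecantCoercive 0 κ₁`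
  (nonlinear Caccioppoli with a common constant, via the LANDED `stub_levelOneGrowth` at `ρ = 0`) give: every
  separated equilibrium globally `1/40`-matched with an admissible hcp-like EQUILIBRIUM datum is an admissible
  two-lattice.  (= the lead's v4 analysis at `τ = 0`; every interface it lands `--supports 9332` serves this stub.)
* `stub_equilibriumAnchoring` — the MIS-ANCHORED regime in reduction form: under the crux's hypotheses `X` is
  globally `1/40`-matched with SOME admissible hcp-like datum whose site set is in force balance.  Sharp in
  sup-norm, hence of Liouville strength whenever the datum is not relaxed; this is where the lead's
  `SecantCoercive (1/20)` is really spent and where any counterexample to the crux lives (long-wave modulated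
  equilibria near the certified long-wave instability of mis-shifted homogeneous hcp — unsearched beyond
  supercells `7×7×4`).

`HcpLiouville_of : HcpLiouville` composes the three BY NAME (`hcpLiouville_iff`, `Iff.rfl`).  `sorry` only in
`stub_*`.  The same cut, as a ROUTE-LEVEL split `HcpLiouville ⇐ AnchoredLiouville + EquilibriumAnchoring`
(children = stubs 1+2 merged, stub 3; glue proved), is prepared in `Cruxes/HcpLiouville/DECOMPOSITION.md`.
-/

noncomputable section

namespace Summit.AtomisticToContinuum.Crystallization.Cruxes.HcpLiouville.Lines.AnchoredSplit

open scoped BigOperators Topology Classical InnerProductSpace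
open Literature.MathematicalPhysics.StatisticalMechanics
open Summit.AtomisticToContinuum.Crystallization.Theses.ExcessDecayLiouville
open Summit.AtomisticToContinuum.Crystallization.Theorems.PhononStabilityNegative
open Summit.AtomisticToContinuum.Crystallization.Theorems.ExcessDecayLiouville

local notation "E3" => EuclideanSpace ℝ (Fin 3)

/-! ## The crux in named form -/

/-- The crux is `PhononStability → Core` over the mirror predicates, by definitional unfolding. -/
theorem hcpLiouville_iff :
    HcpLiouville ↔
      (PhononStability → ∀ δ : ℝ, 0 < δ → ∀ X : Set E3, Sep₀ X δ → Equil₀ X →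
        ∀ (t : Fin 2 → E3) (A : E3 →L[ℝ] E3), Adm₀ A → Inner₀ t A →
          (∀ (c : E3) (r : ℝ), Near₀ X c r t A (1 / 40)) →
            ∃ (t' : Fin 2 → E3) (A' : E3 →L[ℝ] E3), Adm₀ A' ∧ X = Sites₀ t' A') :=
  Iff.rfl

/-! ## The open stubs -/

/-- Stub 1 (ANCHORED RAY-SECANT COERCIVITY; certified computation at ray radius `1/40`, the `ρ = 0` slice of
the lead's `SecantCoercive (1/20)`): for every admissible hcp-like datum whose site set is in force balance and
every field `v` on its sites with `‖v‖ ≤ 1/40`, the θ-averaged second variation along the ray `0 → v` dominates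
`κ₁ ×` the nearest-neighbour strain form of every finitely supported test field. -/
theorem stub_anchoredSecant : ∃ κ₁ : ℝ, 0 < κ₁ ∧ SecantCoercive 0 κ₁ := by
  sorry

/-- Stub 2 (ANCHORED BLOW-DOWN LIOUVILLE; the analysis, `τ = 0`): harmonic stability at admissible hcp-like
data (linear theory: Green's operator `ℓ¹,1 → ℓ²`, interior oscillation decay of `L`-harmonic fields) and
anchored ray-secant coercivity (nonlinear Caccioppoli with a common constant, `stub_levelOneGrowth` at `ρ = 0`)
give the coarse Liouville theorem for EQUILIBRIUM data, by improvement of the normalised ball oscillation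
from `R = ∞` (where boundedness of the displacement is smallness) down to a fixed `R₀`, which forces the
displacement to be constant. -/
theorem stub_anchoredBlowdown :
    PhononStability → ∀ κ₁ : ℝ, 0 < κ₁ → SecantCoercive 0 κ₁ →
      ∀ δ : ℝ, 0 < δ → ∀ X : Set E3, Sep₀ X δ → Equil₀ X →
        ∀ (t : Fin 2 → E3) (A : E3 →L[ℝ] E3), Adm₀ A → Inner₀ t A → Equil₀ (Sites₀ t A) →
          (∀ (c : E3) (r : ℝ), Near₀ X c r t A (1 / 40)) →
            ∃ (t' : Fin 2 → E3) (A' : E3 →L[ℝ] E3), Adm₀ A' ∧ X = Sites₀ t' A' := by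
  sorry

/-- Stub 3 (EQUILIBRIUM ANCHORING; the mis-anchored regime — the open core of the crux): under harmonic
stability, every separated Lennard-Jones equilibrium globally `1/40`-matched with an admissible hcp-like datum is
globally `1/40`-matched with an admissible hcp-like datum whose site set is in force balance. -/
theorem stub_equilibriumAnchoring :
    PhononStability →
      ∀ δ : ℝ, 0 < δ → ∀ X : Set E3, Sep₀ X δ → Equil₀ X →
        ∀ (t : Fin 2 → E3) (A : E3 →L[ℝ] E3), Adm₀ A → Inner₀ t A →
          (∀ (c : E3) (r : ℝ), Near₀ X c r t A (1 / 40)) →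
            ∃ (t'' : Fin 2 → E3) (A'' : E3 →L[ℝ] E3), Adm₀ A'' ∧ Inner₀ t'' A'' ∧
              Equil₀ (Sites₀ t'' A'') ∧ ∀ (c : E3) (r : ℝ), Near₀ X c r t'' A'' (1 / 40) := by
  sorry

/-! ## Composition -/

/-- The anchored regime from stubs 1 and 2 (pure logic). -/
theorem anchoredCore_of_stubs (hPS : PhononStability) :
    ∀ δ : ℝ, 0 < δ → ∀ X : Set E3, Sep₀ X δ → Equil₀ X →
        ∀ (t : Fin 2 → E3) (A : E3 →L[ℝ] E3), Adm₀ A → Inner₀ t A → Equil₀ (Sites₀ t A) →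
          (∀ (c : E3) (r : ℝ), Near₀ X c r t A (1 / 40)) →
            ∃ (t' : Fin 2 → E3) (A' : E3 →L[ℝ] E3), Adm₀ A' ∧ X = Sites₀ t' A' := by
  obtain ⟨κ₁, hκ₁, hSC⟩ := stub_anchoredSecant
  exact stub_anchoredBlowdown hPS κ₁ hκ₁ hSC

/-- **The crux from the line**: `HcpLiouville`, concluded by name — re-anchor the datum with stub 3, conclude
with the anchored regime. -/
theorem HcpLiouville_of : HcpLiouville := by
  rw [hcpLiouville_iff]
  intro hPS δ hδ X hSep hEq t A hA hI hN
  obtain ⟨t'', A'', hA'', hI'', hE'', hN''⟩ := stub_equilibriumAnchoring hPS δ hδ X hSep hEq t A hA hI hN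
  exact anchoredCore_of_stubs hPS δ hδ X hSep hEq t'' A'' hA'' hI'' hE'' hN''

end Summit.AtomisticToContinuum.Crystallization.Cruxes.HcpLiouville.Lines.AnchoredSplit

end
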